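import Literature.NumberTheory.LFunctions.EquivalentsKeiperLiProofs
import Literature.NumberTheory.LFunctions.SmoothedExplicitFormulaContour
import HarnessLib

/-!
# `Re(−ζ'/ζ(s) − 1/(s−1) + Σ_ρ m(ρ)/(s−ρ)) = −½ log π + ½ Re Γ'/Γ(s/2 + 1)` (de la Vallée Poussin's global formula, with multiplicities)

Topic `Literature/NumberTheory/LFunctions`. Everything in this file is PROVED (no named fact).
Kadiri's (1.1) — "celle, dite globale, de De La Vallée Poussin qui regarde tous les zéros avec la
relation `Re(−ζ'/ζ(s)) = −½ log π + ½ Re Γ'/Γ(s/2 + 1) + Re(1/(s−1)) − Σ_ρ Re(1/(s−ρ))`" — with the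
zeros `ρ` of `ζ` counted WITH MULTIPLICITY `m(ρ) = riemannZetaZeroOrder ρ` and the sum over the
subtype of non-trivial zeros absolutely convergent. It is the step of the proof of her Prop. 2.1
(end of §3.1: "La formule d'Hadamard (voir [Dav]) permet de réécrire le terme facteur de `f(0)`")
that turns `−f(0)ζ'/ζ(s)` of the smoothed explicit formula (`SmoothedEF.fordK_eq_explicit_kadiri`,
`SmoothedExplicitFormulaLeftLine.lean`) into `f(0)[−½ log π + ½ Re Γ'/Γ(s/2+1)]`.

Proof: the tree's Hadamard partial fractions `Re ξ'/ξ(s) = Σₖ Re[1/(s−ρₖ) + 1/(s−(1−ρₖ))]` over a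
Hadamard sequence of de Bruijn's `H₀` (`IsHadamardSeq.re_logDeriv_riemannXi_eq_tsum`,
`RiemannXiHadamardProduct.lean`), the multiplicity bookkeeping of the tree's proof of Li's criterion
(`IsHadamardSeq.finsum_liZeroBox_eq_sum`: box sums with multiplicity = sums over Hadamard indices;
`IsHadamardSeq.tendsto_sum_truncation`, `EquivalentsKeiperLiProofs.lean`), absolute convergence of
`Σ m(ρ) Re 1/(s−ρ)` (`|Re 1/(s−ρ)| ≤ (|σ|+1)/|s−ρ|²`), and
`ζ'/ζ = ξ'/ξ − 1/s − 1/(s−1) − Γ_ℝ'/Γ_ℝ`, `Γ_ℝ'/Γ_ℝ(s) = −½ log π + ½ ψ(s/2+1) − 1/s`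
(`ExplicitFormulaPsiOne.lean`).

* `Literature.NumberTheory.LFunctions.hasSum_zeroOrder_mul_re_inv_sub` —
  `Σ_ρ m(ρ) Re 1/(s−ρ) = Re ξ'/ξ(s)` (`ξ(s) ≠ 0`), absolutely convergent;
* `Literature.NumberTheory.LFunctions.re_neg_logDeriv_zeta_hadamard` — Kadiri's (1.1) with
  multiplicities, for `−1 < Re s`, `s ≠ 0, 1`, `ζ(s) ≠ 0`.

## References

* H. Kadiri, Acta Arith. 117 (2005) = arXiv:math/0401238, (1.1) and §3.1 (end). (`Kadiri2005`)
* H. Davenport, *Multiplicative Number Theory*, 3rd ed., Ch. 12, (8)–(11). (`DavenportMNT1980`)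
-/

noncomputable section

open Complex Real Filter Topology Set
open scoped ComplexConjugate

namespace Literature.NumberTheory.LFunctions

/-! ## Absolute convergence of `Σ m(ρ) Re 1/(s − ρ)` -/

/-- **`Σ_ρ m(ρ) |Re 1/(s−ρ)| < ∞`** at every `s` which is not a zero (`|Re 1/(s−ρ)| ≤ (|σ|+1)/|s−ρ|²`
and `Σ m(ρ)/(1+γ²) < ∞`). [folklore] -/
theorem summable_norm_zeroOrder_mul_re_inv_sub {s : ℂ} (hζs : riemannZeta s ≠ 0) :
    Summable fun ρ : RHWave0.riemannZetaNontrivialZeros ↦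
      ‖(riemannZetaZeroOrder (ρ : ℂ) : ℝ) * (1 / (s - ρ)).re‖ := by
  obtain ⟨d, hd0, hd1, hd⟩ := SmoothedEF.exists_dist_zeros_ge hζs
  set C : ℝ := (1 + 2 * s.im ^ 2) / d ^ 2 + 2 with hC
  set A : ℝ := |s.re| + 1 with hA
  refine Summable.of_nonneg_of_le (fun _ ↦ norm_nonneg _) (fun ρ ↦ ?_)
    (ZetaZeroSum.summable_zeroOrder_div_one_add_sq.mul_left (A * C))
  have hm := ZetaZeroSum.zeroOrder_nonneg ρ
  have hρ := ρ.2
  have hre0 := ZetaZeros.riemannZetaNontrivialZeros.re_pos hρ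
  have hre1 := ZetaZeros.riemannZetaNontrivialZeros.re_lt_one hρ
  have hdρ := hd _ hρ
  have hpos : 0 < ‖s - (ρ : ℂ)‖ := hd0.trans_le hdρ
  rw [norm_mul, Real.norm_eq_abs, abs_of_nonneg hm, Real.norm_eq_abs, IsHadamardSeq.re_inv_sub_eq, abs_div,
    abs_of_pos (by positivity : 0 < ‖s - (ρ : ℂ)‖ ^ 2)]
  have hnum : |s.re - (ρ : ℂ).re| ≤ A := by
    rw [hA]
    refine (abs_sub _ _).trans ?_
    rw [abs_of_pos hre0]
    linarith
  -- `1 + γ² ≤ C ‖s − ρ‖²`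
  have hn2 : (s.im - (ρ : ℂ).im) ^ 2 ≤ ‖s - ρ‖ ^ 2 := by
    have := Complex.abs_im_le_norm (s - ρ)
    rw [sub_im] at this
    nlinarith [abs_nonneg (s.im - (ρ : ℂ).im), sq_abs (s.im - (ρ : ℂ).im)]
  have hd2 : d ^ 2 ≤ ‖s - ρ‖ ^ 2 := by nlinarith [norm_nonneg (s - (ρ : ℂ))]
  have hkey : 1 + (ρ : ℂ).im ^ 2 ≤ C * ‖s - ρ‖ ^ 2 := by
    have h1 : (ρ : ℂ).im ^ 2 ≤ 2 * (s.im - (ρ : ℂ).im) ^ 2 + 2 * s.im ^ 2 := by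
      nlinarith [sq_nonneg (2 * s.im - (ρ : ℂ).im)]
    have h2 : 1 + 2 * s.im ^ 2 ≤ (1 + 2 * s.im ^ 2) / d ^ 2 * ‖s - ρ‖ ^ 2 := by
      rw [div_mul_eq_mul_div, le_div_iff₀ (by positivity)]
      exact mul_le_mul_of_nonneg_left hd2 (by positivity)
    calc 1 + (ρ : ℂ).im ^ 2 ≤ (1 + 2 * s.im ^ 2) + 2 * (s.im - (ρ : ℂ).im) ^ 2 := by linarith
      _ ≤ (1 + 2 * s.im ^ 2) / d ^ 2 * ‖s - ρ‖ ^ 2 + 2 * ‖s - ρ‖ ^ 2 := by linarith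
      _ = C * ‖s - ρ‖ ^ 2 := by rw [hC]; ring
  have hpos2 : 0 < ‖s - (ρ : ℂ)‖ ^ 2 := by positivity
  calc (riemannZetaZeroOrder (ρ : ℂ) : ℝ) * (|s.re - (ρ : ℂ).re| / ‖s - ρ‖ ^ 2)
      ≤ (riemannZetaZeroOrder (ρ : ℂ) : ℝ) * (A / ‖s - ρ‖ ^ 2) := by gcongr
    _ ≤ (riemannZetaZeroOrder (ρ : ℂ) : ℝ) * (A * C / (1 + (ρ : ℂ).im ^ 2)) := by
        refine mul_le_mul_of_nonneg_left ?_ hm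
        rw [div_le_div_iff₀ hpos2 (by positivity)]
        calc A * (1 + (ρ : ℂ).im ^ 2) ≤ A * (C * ‖s - ρ‖ ^ 2) :=
              mul_le_mul_of_nonneg_left hkey (by positivity)
          _ = A * C * ‖s - ρ‖ ^ 2 := by ring
    _ = A * C * ((riemannZetaZeroOrder (ρ : ℂ) : ℝ) / (1 + (ρ : ℂ).im ^ 2)) := by ring

/-! ## The sum over the zeros with multiplicity is `Re ξ'/ξ` -/

/-- `liZeroBox T = weilZeroIndex T` (the two names of the tree for the zeros with `|Im ρ| ≤ T`).
[folklore] -/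
theorem liZeroBox_eq_weilZeroIndex (T : ℝ) : liZeroBox T = weilZeroIndex T := by
  ext ρ
  simp only [liZeroBox, weilZeroIndex, Set.mem_setOf_eq, abs_pos]

/-- **`Σ_ρ m(ρ) Re 1/(s−ρ) = Re ξ'/ξ(s)`** over the non-trivial zeros of `ζ` with multiplicity, at
every `s` with `ζ(s) ≠ 0` (from the Hadamard partial fractions of `ξ'/ξ` over a Hadamard sequence
and the multiplicity bookkeeping `#{k : ρ ∈ {ρₖ, 1−ρₖ}} = m(ρ)`). [cite: Kadiri2005, (1.1)] -/
theorem hasSum_zeroOrder_mul_re_inv_sub {s : ℂ} (hζs : riemannZeta s ≠ 0) :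
    HasSum (fun ρ : RHWave0.riemannZetaNontrivialZeros ↦
      (riemannZetaZeroOrder (ρ : ℂ) : ℝ) * (1 / (s - ρ)).re) (logDeriv riemannXi s).re := by
  classical
  have hξ : riemannXi s ≠ 0 := fun h ↦ hζs ((riemannXi_eq_zero_iff_holds s).1 h).1
  obtain ⟨b, hb⟩ := exists_isHadamardSeq 0
  -- the real-valued and complex-valued series over the Hadamard indices
  set F : ℂ → ℂ := fun ρ ↦ ((1 / (s - ρ)).re : ℂ) with hF
  set G : ℕ → ℂ := fun k ↦ if b k = 0 then 0 else (F (IsHadamardSeq.xiZero b k) + F (1 - IsHadamardSeq.xiZero b k)) with hG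
  have hre := hb.re_logDeriv_riemannXi_eq_tsum hξ
  have hsumR : Summable fun n ↦ if b n = 0 then (0 : ℝ) else
      (1 / (s - IsHadamardSeq.xiZero b n)).re + (1 / (s - (1 - IsHadamardSeq.xiZero b n))).re := by
    have := (hb.summable_pairs hξ).mapL Complex.reCLM
    refine this.congr fun n ↦ ?_
    simp only [Complex.reCLM_apply]
    split_ifs <;> simp
  have hGsum : HasSum G ((logDeriv riemannXi s).re : ℂ) := by
    rw [hre]
    have h1 := (Complex.hasSum_ofReal.2 hsumR.hasSum)
    refine h1.congr_fun fun n ↦ ?_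
    simp only [hG, hF]
    split_ifs <;> push_cast <;> rfl
  have hG0 : ∀ k, b k = 0 → G k = 0 := fun k hk ↦ by simp [hG, hk]
  -- the truncations
  set K : ℝ → Finset ℕ := fun T ↦ (hb.finite_setOf_abs_im_xiZero_le T).toFinset with hK
  have hKmem : ∀ T k, k ∈ K T ↔ b k ≠ 0 ∧ |(IsHadamardSeq.xiZero b k).im| ≤ T := fun T k ↦ by
    rw [hK, Set.Finite.mem_toFinset]; rfl
  have hlim1 : Tendsto (fun T ↦ ∑ k ∈ K T, G k) atTop (𝓝 ((logDeriv riemannXi s).re : ℂ)) :=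
    IsHadamardSeq.tendsto_sum_truncation hGsum hG0 K hKmem
  -- box sums with multiplicity
  have hbox : ∀ T, ∑ ρ ∈ weilZeroFinset T, (riemannZetaZeroOrder (ρ : ℂ) : ℂ) * F ρ = ∑ k ∈ K T, G k := by
    intro T
    rw [← ZetaZeroSum.finsum_mem_weilZeroIndex_eq_sum (fun ρ ↦ (riemannZetaZeroOrder ρ : ℂ) * F ρ) T,
      ← liZeroBox_eq_weilZeroIndex, hb.finsum_liZeroBox_eq_sum F T (K T) (hKmem T)]
    refine Finset.sum_congr rfl fun k hk ↦ ?_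
    simp [hG, ((hKmem T k).1 hk).1]
  -- the absolutely convergent sum over the subtype
  have habs := summable_norm_zeroOrder_mul_re_inv_sub hζs
  have hsumC : Summable fun ρ : RHWave0.riemannZetaNontrivialZeros ↦
      (riemannZetaZeroOrder (ρ : ℂ) : ℂ) * F ρ := by
    refine .of_norm (habs.congr fun ρ ↦ ?_)
    simp only [hF, norm_mul, Complex.norm_intCast, Complex.norm_real, Real.norm_eq_abs]
  have hlim2 : Tendsto (fun T ↦ ∑ ρ ∈ weilZeroFinset T, (riemannZetaZeroOrder (ρ : ℂ) : ℂ) * F ρ)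
      atTop (𝓝 (∑' ρ : RHWave0.riemannZetaNontrivialZeros, (riemannZetaZeroOrder (ρ : ℂ) : ℂ) * F ρ)) :=
    hsumC.hasSum.comp tendsto_weilZeroFinset
  have heq : (∑' ρ : RHWave0.riemannZetaNontrivialZeros, (riemannZetaZeroOrder (ρ : ℂ) : ℂ) * F ρ) =
      ((logDeriv riemannXi s).re : ℂ) :=
    tendsto_nhds_unique hlim2 (hlim1.congr fun T ↦ (hbox T).symm)
  -- back to real numbers
  have hsumR' : Summable fun ρ : RHWave0.riemannZetaNontrivialZeros ↦
      (riemannZetaZeroOrder (ρ : ℂ) : ℝ) * (1 / (s - ρ)).re := habs.of_norm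
  have hcast : ∀ ρ : RHWave0.riemannZetaNontrivialZeros,
      (((riemannZetaZeroOrder (ρ : ℂ) : ℝ) * (1 / (s - ρ)).re : ℝ) : ℂ) =
        (riemannZetaZeroOrder (ρ : ℂ) : ℂ) * F ρ := fun ρ ↦ by
    simp only [hF]; push_cast; rfl
  have h2 : ((∑' ρ : RHWave0.riemannZetaNontrivialZeros,
      (riemannZetaZeroOrder (ρ : ℂ) : ℝ) * (1 / (s - ρ)).re : ℝ) : ℂ) = ((logDeriv riemannXi s).re : ℂ) := by
    rw [Complex.ofReal_tsum]
    simp_rw [hcast]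
    exact heq
  have h3 := Complex.ofReal_injective h2
  rw [← h3]
  exact hsumR'.hasSum

/-- **Kadiri's (1.1) with multiplicities** (de la Vallée Poussin's global formula; Davenport Ch. 12
(8)–(11)): for `−1 < Re s`, `s ≠ 0`, `s ≠ 1`, `ζ(s) ≠ 0`,
`Re(−ζ'/ζ(s)) − Re 1/(s−1) + Σ_ρ m(ρ) Re 1/(s−ρ) = −½ log π + ½ Re ψ(s/2 + 1)`,
the sum over the non-trivial zeros with multiplicity, absolutely convergent
(`summable_norm_zeroOrder_mul_re_inv_sub`). [cite: Kadiri2005, (1.1)] -/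
theorem re_neg_logDeriv_zeta_hadamard {s : ℂ} (hσ : -1 < s.re) (h0 : s ≠ 0) (h1 : s ≠ 1)
    (hζs : riemannZeta s ≠ 0) :
    (-(deriv riemannZeta s / riemannZeta s)).re - (1 / (s - 1)).re +
        ∑' ρ : RHWave0.riemannZetaNontrivialZeros, (riemannZetaZeroOrder (ρ : ℂ) : ℝ) * (1 / (s - ρ)).re =
      -(Real.log π) / 2 + (digamma (s / 2 + 1)).re / 2 := by
  rw [(hasSum_zeroOrder_mul_re_inv_sub hζs).tsum_eq,
    PsiOneExplicit.logDeriv_riemannZeta_eq_logDeriv_riemannXi hσ h0 h1 hζs,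
    PsiOneExplicit.logDeriv_Gammaℝ_eq_shift hσ h0, ← Complex.ofReal_log Real.pi_pos.le]
  simp only [sub_re, add_re, neg_re, Complex.div_ofNat_re, Complex.ofReal_re]
  ring

end Literature.NumberTheory.LFunctions
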